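import Summits.CriticalPhenomena.PercolationContinuityZ3.Theorems.PercNearOneGluingNoHeavyLowerTailIncStarIrreducibleTools
import Summits.CriticalPhenomena.PercolationContinuityZ3.Theorems.PercNearOneGluingNoHeavyLowerTailIncStarTargetTargetStep
import Summits.CriticalPhenomena.PercolationContinuityZ3.Theorems.PercNearOneGluingNoHeavyLowerTailIncStarRootTargetStep
import HarnessLib

/-!
# The increasing star: the Bernstein step along a MARK–MARK pair (root–target or target–target)

Support file for the Sahi programme (`--supports stmt-CriticalPhenomena-4575`, prover prim-sahi-p2 gen 13).  No definitions, no named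
facts, no sorries; standard axioms.  Memo `…/prim-sahi-p2/PROOF-E3.md` §24, `FROM-prim-sahi-p2-gen13-INDEPENDENT-MARKS.md`.

Along a pair `e` the increasing star `E₃({s↔t₁},{s↔t₂},{s↔t₃})` is a Bernstein cubic in `p_e` (`EdgeInduction.sahiE3_oneBond`) with end
coefficients the star under `w[e↦0]` and under `w[e↦1]` and mixed coefficients `polar₁`.  For a ROOT–TARGET pair `e = s(s,t₁)` and for a
TARGET–TARGET pair `e = s(t₁,t₂)`:
* the end coefficient at `p_e = 1` is nonnegative outright — `Cov(1_{s↔t₂},1_{s↔t₃}) ≥ 0` when `t₁` is glued to the root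
  (`incStar_rootTarget_one`), resp. `(1 − q)(2q' − q q'') ≥ 0` when the two targets are glued (`incStar_targetTarget_one`; Harris);
* the two mixed coefficients are nonnegative as soon as the star holds under `w[e↦0]`, by the exact degree-3 cone certificates
  `IncStar.rootTarget_polar_nonneg` (gen 4) and `IncStar.targetTarget_polar_nonneg` (gen 13).
Hence (`incStar_step_rootTarget`, `incStar_step_targetTarget`) the star under `w` follows from the star under `w[e↦0]` alone — the edge step
that lets the reduction theorem `IncStarIrreducible.incStar_of_irreducible_indep` (…IncStarIrreducibleIndep) assume that the four marks of an
irreducible marked graph form an independent set.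
-/

noncomputable section

namespace Summit.CriticalPhenomena.PercolationContinuityZ3.Theorems

namespace IncStarIrreducible

open Finset MeasureTheory Literature.Combinatorics.Sahi2008 Literature.Probability.Percolation
  Literature.Probability.LatticeModels EdgeInduction
open Literature.Probability.Percolation.DecisionTree (ind ind_of_mem ind_of_not_mem ind_nonneg)
open Literature.Probability.Percolation.BlockExploration (exists_openWalk_of_mem_openConnIn
  mem_openConn_iff_openConnIn_univ)
open scoped Classical

variable {n : ℕ}

/-! ### The two end coefficients at `p_e = 1` -/

/-- **Root glued to a target**: under `P_{w[s(s,t₁)↦1]}` the event `{s↔t₁}` is almost sure and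
`E₃({s↔t₁},{s↔t₂},{s↔t₃}) = Cov(1_{s↔t₂}, 1_{s↔t₃}) ≥ 0` (Harris). [this work] -/
theorem incStar_rootTarget_one (w : Sym2 (Fin n) → unitInterval) {s t₁ : Fin n} (t₂ t₃ : Fin n) (hst : s ≠ t₁) :
    0 ≤ sahiE3 (prodBernoulli (Function.update w s(s, t₁) 1)) (openConn s t₁) (openConn s t₂) (openConn s t₃) := by
  have L : ∀ S : Set (BondConfig (Fin n)), (prodBernoulli (Function.update w s(s, t₁) 1)).real S =
      (prodBernoulli (Function.update w s(s, t₁) 0)).real ((fun ω : BondConfig (Fin n) => insert s(s, t₁) ω) ⁻¹' S) :=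
    tieLiftOne_real_one_eq w s(s, t₁)
  have pA : (fun ω : BondConfig (Fin n) => insert s(s, t₁) ω) ⁻¹' openConn s t₁ = Set.univ := by
    rw [IncStar.preimage_insert_openConn hst, openConn_self]; exact Set.union_univ _
  have h1 : (prodBernoulli (Function.update w s(s, t₁) 1)).real (openConn s t₁) = 1 := by rw [L, pA]; exact probReal_univ
  have h2 : (prodBernoulli (Function.update w s(s, t₁) 1)).real (openConn s t₁ ∩ openConn s t₂ ∩ openConn s t₃) =
      (prodBernoulli (Function.update w s(s, t₁) 1)).real (openConn s t₂ ∩ openConn s t₃) := by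
    rw [L, L (openConn s t₂ ∩ openConn s t₃), Set.preimage_inter, Set.preimage_inter, Set.preimage_inter, pA, Set.univ_inter]
  have h3 : (prodBernoulli (Function.update w s(s, t₁) 1)).real (openConn s t₁ ∩ openConn s t₂) =
      (prodBernoulli (Function.update w s(s, t₁) 1)).real (openConn s t₂) := by
    rw [L, L (openConn s t₂), Set.preimage_inter, pA, Set.univ_inter]
  have h4 : (prodBernoulli (Function.update w s(s, t₁) 1)).real (openConn s t₁ ∩ openConn s t₃) =
      (prodBernoulli (Function.update w s(s, t₁) 1)).real (openConn s t₃) := by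
    rw [L, L (openConn s t₃), Set.preimage_inter, pA, Set.univ_inter]
  have hhar := prodBernoulli_harris (Function.update w s(s, t₁) 1) (isUpperSet_openConn (V := Fin n) s t₂)
    (isUpperSet_openConn (V := Fin n) s t₃) MeasurableSet.of_discrete MeasurableSet.of_discrete
  rw [sahiE3_def, h1, h2, h3, h4]
  linarith

/-- **Two targets glued together**: under `P_{w[s(t₁,t₂)↦1]}` the events `{s↔t₁}`, `{s↔t₂}` almost surely coincide and
`E₃({s↔t₁},{s↔t₂},{s↔t₃}) = (1 − q)(2q' − q·q'') ≥ 0` with `q = P(s↔t₁)`, `q'' = P(s↔t₃)`, `q' = P(s↔t₁, s↔t₃) ≥ q·q''` (Harris). [this work] -/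
theorem incStar_targetTarget_one (w : Sym2 (Fin n) → unitInterval) (s t₁ t₂ t₃ : Fin n) :
    0 ≤ sahiE3 (prodBernoulli (Function.update w s(t₁, t₂) 1)) (openConn s t₁) (openConn s t₂) (openConn s t₃) := by
  set w0 := Function.update w s(t₁, t₂) 0 with hw0
  have L : ∀ S : Set (BondConfig (Fin n)), (prodBernoulli (Function.update w s(t₁, t₂) 1)).real S =
      (prodBernoulli w0).real ((fun ω : BondConfig (Fin n) => insert s(t₁, t₂) ω) ⁻¹' S) :=
    tieLiftOne_real_one_eq w s(t₁, t₂)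
  have pA : (fun ω : BondConfig (Fin n) => insert s(t₁, t₂) ω) ⁻¹' openConn s t₁ = openConn s t₁ ∪ openConn s t₂ := by
    ext ω
    simp only [Set.mem_preimage, Set.mem_union, IncStar.insert_pair_mem_openConn_iff, openConn_self, Set.mem_univ, true_or,
      and_true]
    tauto
  have pB : (fun ω : BondConfig (Fin n) => insert s(t₁, t₂) ω) ⁻¹' openConn s t₂ = openConn s t₁ ∪ openConn s t₂ := by
    ext ω
    simp only [Set.mem_preimage, Set.mem_union, IncStar.insert_pair_mem_openConn_iff, openConn_self, Set.mem_univ, or_true,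
      and_true]
    tauto
  have pC := IncStar.preimage_insert_pair_openConn (V := Fin n) t₁ t₂ s t₃
  set U : Set (BondConfig (Fin n)) := openConn s t₁ ∪ openConn s t₂ with hU
  set C' : Set (BondConfig (Fin n)) := (fun ω : BondConfig (Fin n) => insert s(t₁, t₂) ω) ⁻¹' openConn s t₃ with hC'
  have hUup : IsUpperSet U := (isUpperSet_openConn (V := Fin n) s t₁).union (isUpperSet_openConn (V := Fin n) s t₂)
  have hCup : IsUpperSet C' := by
    rw [pC]
    exact (isUpperSet_openConn (V := Fin n) s t₃).union
      (hUup.inter ((isUpperSet_openConn (V := Fin n) t₁ t₃).union (isUpperSet_openConn (V := Fin n) t₂ t₃)))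
  have e1 : (prodBernoulli (Function.update w s(t₁, t₂) 1)).real (openConn s t₁) = (prodBernoulli w0).real U := by rw [L, pA]
  have e2 : (prodBernoulli (Function.update w s(t₁, t₂) 1)).real (openConn s t₂) = (prodBernoulli w0).real U := by rw [L, pB]
  have e3 : (prodBernoulli (Function.update w s(t₁, t₂) 1)).real (openConn s t₃) = (prodBernoulli w0).real C' := by rw [L]
  have e4 : (prodBernoulli (Function.update w s(t₁, t₂) 1)).real (openConn s t₁ ∩ openConn s t₂) = (prodBernoulli w0).real U := by
    rw [L, Set.preimage_inter, pA, pB, Set.inter_self]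
  have e5 : (prodBernoulli (Function.update w s(t₁, t₂) 1)).real (openConn s t₁ ∩ openConn s t₃) =
      (prodBernoulli w0).real (U ∩ C') := by rw [L, Set.preimage_inter, pA]
  have e6 : (prodBernoulli (Function.update w s(t₁, t₂) 1)).real (openConn s t₂ ∩ openConn s t₃) =
      (prodBernoulli w0).real (U ∩ C') := by rw [L, Set.preimage_inter, pB]
  have e7 : (prodBernoulli (Function.update w s(t₁, t₂) 1)).real (openConn s t₁ ∩ openConn s t₂ ∩ openConn s t₃) =
      (prodBernoulli w0).real (U ∩ C') := by rw [L, Set.preimage_inter, Set.preimage_inter, pA, pB, Set.inter_self]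
  have hhar := prodBernoulli_harris w0 hUup hCup MeasurableSet.of_discrete MeasurableSet.of_discrete
  have hU1 : (prodBernoulli w0).real U ≤ 1 := measureReal_le_one
  have hUC0 : 0 ≤ (prodBernoulli w0).real (U ∩ C') := measureReal_nonneg
  have hC0 : 0 ≤ (prodBernoulli w0).real C' := measureReal_nonneg
  rw [sahiE3_def, e1, e2, e3, e4, e5, e6, e7]
  have key : 0 ≤ (1 - (prodBernoulli w0).real U) * (2 * (prodBernoulli w0).real (U ∩ C') -
      (prodBernoulli w0).real U * (prodBernoulli w0).real C') :=
    mul_nonneg (sub_nonneg.2 hU1) (by nlinarith [hhar, hUC0, mul_nonneg (measureReal_nonneg : 0 ≤ (prodBernoulli w0).real U) hC0])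
  linarith [key]

/-! ### The Bernstein step at a mark–mark pair -/

/-- Bernstein positivity: if the four Bernstein coefficients of `p_e ↦ E₃(A,B,C)` are nonnegative, so is `E₃`. [folklore] -/
theorem sahiE3_nonneg_of_bernsteinCoeffs (w : Sym2 (Fin n) → unitInterval) (e : Sym2 (Fin n)) (A B C : Set (BondConfig (Fin n)))
    (h0 : 0 ≤ sahiE3 (prodBernoulli (Function.update w e 0)) A B C)
    (h1 : 0 ≤ polar₁ (prodBernoulli (Function.update w e 0)) (prodBernoulli (Function.update w e 1)) A B C)
    (h2 : 0 ≤ polar₁ (prodBernoulli (Function.update w e 1)) (prodBernoulli (Function.update w e 0)) A B C)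
    (h3 : 0 ≤ sahiE3 (prodBernoulli (Function.update w e 1)) A B C) :
    0 ≤ sahiE3 (prodBernoulli w) A B C := by
  have hp0 : (0 : ℝ) ≤ w e := (w e).2.1
  have hp1 : (w e : ℝ) ≤ 1 := (w e).2.2
  rw [sahiE3_oneBond w e A B C]
  have hq : (0 : ℝ) ≤ 1 - w e := sub_nonneg.2 hp1
  positivity

/-- **The root–target edge step** (gen 4's certificate + the glued end): the star under `w` follows from the star under `w[s(s,t₁)↦0]`. [this work] -/
theorem incStar_step_rootTarget (w : Sym2 (Fin n) → unitInterval) {s t₁ : Fin n} (t₂ t₃ : Fin n) (hst : s ≠ t₁)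
    (h0 : 0 ≤ sahiE3 (prodBernoulli (Function.update w s(s, t₁) 0)) (openConn s t₁) (openConn s t₂) (openConn s t₃)) :
    0 ≤ sahiE3 (prodBernoulli w) (openConn s t₁) (openConn s t₂) (openConn s t₃) := by
  obtain ⟨h1, h2⟩ := IncStar.rootTarget_polar_nonneg w s t₁ t₂ t₃ hst h0
  exact sahiE3_nonneg_of_bernsteinCoeffs w s(s, t₁) _ _ _ h0 h1 h2 (incStar_rootTarget_one w t₂ t₃ hst)

/-- **The target–target edge step** (gen 13's certificate + the glued end): the star under `w` follows from the star under `w[s(t₁,t₂)↦0]`. [this work] -/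
theorem incStar_step_targetTarget (w : Sym2 (Fin n) → unitInterval) (s t₁ t₂ t₃ : Fin n)
    (h0 : 0 ≤ sahiE3 (prodBernoulli (Function.update w s(t₁, t₂) 0)) (openConn s t₁) (openConn s t₂) (openConn s t₃)) :
    0 ≤ sahiE3 (prodBernoulli w) (openConn s t₁) (openConn s t₂) (openConn s t₃) := by
  obtain ⟨h1, h2⟩ := IncStar.targetTarget_polar_nonneg w s t₁ t₂ t₃ h0
  exact sahiE3_nonneg_of_bernsteinCoeffs w s(t₁, t₂) _ _ _ h0 h1 h2 (incStar_targetTarget_one w s t₁ t₂ t₃)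

end IncStarIrreducible

end Summit.CriticalPhenomena.PercolationContinuityZ3.Theorems
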